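import Summits.HodgeConjecture.CorCM.Census.QuaternionColumnBlockCount

/-!
# The quaternion column, block count II: the divisor sum `β(Q_{4n}) · 4n = Σ_{d ∣ 2n, d odd} φ(d)·2^{2n/d}` and the explicit law for even `n`

COR-CM (cell `pub-hodgecm2`), count-neutral kernel combinatorics by the binder seat b09 (gen 40; lane RELATIVE SPLITTING, part XII), on part XI
(`card_block_mul_card_quaternion`, Burnside read through the parity criterion), Mathlibʼs `QuaternionGroup.orderOf_a`, `orderOf_xa`, `ZMod.addOrderOf_coe`,
`IsAddCyclic.card_addOrderOf_eq_totient`, and part Xʼs law `isLeast_card_gfaces_generate_quaternion_even_card_block`, all BY NAME.  Theorems only: no definition (the rotation/reflection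
equivalence is a local `let`), no `decide` beyond closed numerals, no certificate, no named fact, no `sorry`.
HONEST FRAMING: `HC_CM` is NOT proved, here or anywhere in the tree; nothing here is a period or a headline.

* §1 The Burnside sum over `Q_{4n}` splits into rotations and reflections; reflections have order `4` and drop out; a rotation `a i` has the additive order of `i`
  in `ℤ/2n`, so the rotations regroup by order: **`β(Q_{4n}, c) · 4n = Σ_{d ∣ 2n, d odd} φ(d) · 2^{2n/d}`** (`card_block_mul_card_eq_sum_divisors`, every `n ≥ 1`) —
  the same divisor sum as the cyclic column `ℤ/4n`… of HALF the length: `β(Q_{4n}) · 4n = β(ℤ/4n)·4n` read with `2n` in place of `2n`; e.g. `Q₂₄`: `(2¹² + 2·2⁴)/24 = 172`.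
* §2 **THE LAW AS A NUMBER** (`isLeast_card_gfaces_generate_quaternion_even_explicit`): for every even `n ≥ 4`,
  `μ(Q_{4n}, c) · 4n = Σ_{d ∣ 2n, d odd} φ(d)·2^{2n/d}`, stated as `IsLeast … ((Σ …) / (4n))`; `μ(Q₂₄) = 172` (`isLeast_card_gfaces_generate_quaternion_twentyFour`).

## References
* [Pohlmann1968] H. Pohlmann, Algebraic cycles on abelian varieties of complex multiplication type, Ann. of Math. 88 (1968), Thm 1.
* [Milne1999] J. S. Milne, Lefschetz motives and the Tate conjecture, Compositio Math. 117 (1999), Prop. 2.1, p. 54.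
-/

namespace Summit.HodgeConjecture.CorCM.Census.QuaternionColumn

open Finset QuaternionGroup
open Summit.HodgeConjecture.CorCM.Prior.AllgGroup.RfwfAllgGroup
open Summit.HodgeConjecture.CorCM.Census.BlockParity
open Summit.HodgeConjecture.CorCM.Census.Coinvariant

noncomputable section

variable {n : ℕ} [NeZero n]

/-! ## §1 The divisor sum -/

/-- The order of a rotation `a i` is the additive order of `i` in `ℤ/2n`. [folklore] -/
theorem orderOf_a_eq_addOrderOf (i : ZMod (2 * n)) : orderOf (a i : QuaternionGroup n) = addOrderOf i := by
  have hn : 2 * n ≠ 0 := by have := NeZero.ne n; omega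
  rw [orderOf_a]
  conv_rhs => rw [← ZMod.natCast_zmod_val i]
  rw [ZMod.addOrderOf_coe _ hn]

/-- **THE DIVISOR SUM**: `β(Q_{4n}, c) · 4n = Σ_{d ∣ 2n, d odd} φ(d) · 2^{2n/d}`, for every `n ≥ 1`. [folklore] -/
theorem card_block_mul_card_eq_sum_divisors :
    Fintype.card (Block (c n)) * (4 * n) = ∑ d ∈ (2 * n).divisors with Odd d, Nat.totient d * 2 ^ (2 * n / d) := by
  classical
  have hn := NeZero.ne n
  -- `Q_{4n}` as the disjoint union of its rotations and reflections
  let sumEquiv : ZMod (2 * n) ⊕ ZMod (2 * n) ≃ QuaternionGroup n :=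
    { toFun := fun x => match x with
        | Sum.inl i => a i
        | Sum.inr j => xa j
      invFun := fun g => match g with
        | a i => Sum.inl i
        | xa j => Sum.inr j
      left_inv := fun x => by cases x <;> rfl
      right_inv := fun g => by cases g <;> rfl }
  rw [card_block_mul_card_quaternion, ← Fintype.sum_equiv sumEquiv
    (fun x => if Even (orderOf (sumEquiv x)) then 0 else 2 ^ (4 * n / orderOf (sumEquiv x) / 2)) _ (fun x => rfl),
    Fintype.sum_sum_type]
  -- reflections have order `4` and drop out
  have hxa : ∑ j : ZMod (2 * n), (if Even (orderOf (sumEquiv (Sum.inr j) : QuaternionGroup n)) then 0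
      else 2 ^ (4 * n / orderOf (sumEquiv (Sum.inr j) : QuaternionGroup n) / 2)) = 0 := by
    refine Finset.sum_eq_zero fun j _ => ?_
    have e : (sumEquiv (Sum.inr j) : QuaternionGroup n) = xa j := rfl
    rw [e, orderOf_xa, if_pos (by decide)]
  rw [hxa, add_zero]
  -- rotations: regroup by the additive order of the index
  have hterm : ∀ i : ZMod (2 * n), (if Even (orderOf (sumEquiv (Sum.inl i) : QuaternionGroup n)) then 0
      else 2 ^ (4 * n / orderOf (sumEquiv (Sum.inl i) : QuaternionGroup n) / 2)) =
        (fun d => if Odd d then 2 ^ (2 * n / d) else 0) (addOrderOf i) := by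
    intro i
    have e : (sumEquiv (Sum.inl i) : QuaternionGroup n) = a i := rfl
    simp only [e, orderOf_a_eq_addOrderOf]
    by_cases hodd : Odd (addOrderOf i)
    · rw [if_neg (Nat.not_even_iff_odd.mpr hodd), if_pos hodd]
      have hdvd : addOrderOf i ∣ 2 * n := by
        have h := addOrderOf_dvd_card (x := i); rwa [ZMod.card] at h
      obtain ⟨k, hk⟩ := hdvd
      have hpos : 0 < addOrderOf i := addOrderOf_pos i
      have h1 : 4 * n / addOrderOf i = 2 * k := Nat.div_eq_of_eq_mul_left hpos (by linarith)
      have h2 : 2 * n / addOrderOf i = k := Nat.div_eq_of_eq_mul_left hpos (by linarith)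
      congr 1
      rw [h1, h2]
      omega
    · rw [if_pos (Nat.not_odd_iff_even.mp hodd), if_neg hodd]
  have hmaps : ∀ i ∈ (Finset.univ : Finset (ZMod (2 * n))), addOrderOf i ∈ (2 * n).divisors := fun i _ =>
    Nat.mem_divisors.mpr ⟨by simpa only [ZMod.card] using (addOrderOf_dvd_card (x := i)), by omega⟩
  rw [Finset.sum_congr rfl (fun i _ => hterm i), ← Finset.sum_fiberwise_of_maps_to' hmaps (fun d => if Odd d then 2 ^ (2 * n / d) else 0),
    Finset.sum_filter]
  refine Finset.sum_congr rfl fun d hd => ?_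
  have hdvd : d ∣ Fintype.card (ZMod (2 * n)) := by rw [ZMod.card]; exact Nat.dvd_of_mem_divisors hd
  rw [Finset.sum_const, smul_eq_mul, IsAddCyclic.card_addOrderOf_eq_totient hdvd]
  by_cases hodd : Odd d
  · rw [if_pos hodd, if_pos hodd]
  · rw [if_neg hodd, if_neg hodd, mul_zero]

/-! ## §2 The law as a number -/

/-- **`μ(Q_{4n}, c) = (Σ_{d ∣ 2n, d odd} φ(d)·2^{2n/d}) / 4n` for every even `n ≥ 4`.** [folklore] -/
theorem isLeast_card_gfaces_generate_quaternion_even_explicit (heven : Even n) (h4 : 4 ≤ n) :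
    IsLeast {k : ℕ | ∃ S : Finset (CMF (QuaternionGroup n) (c n) →₀ ℤ), (↑S ⊆ gfaceSet (QuaternionGroup n) (c n) c_mul_c) ∧ S.card = k ∧
      hodgeSpan (c n) c_mul_c ≤ Submodule.span ℤ (pairSet (c n)) ⊔ Submodule.span ℤ (translates (c n) S)}
      ((∑ d ∈ (2 * n).divisors with Odd d, Nat.totient d * 2 ^ (2 * n / d)) / (4 * n)) := by
  have hnz := NeZero.ne n
  have hβ : Fintype.card (Block (c n)) = (∑ d ∈ (2 * n).divisors with Odd d, Nat.totient d * 2 ^ (2 * n / d)) / (4 * n) := by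
    rw [← card_block_mul_card_eq_sum_divisors, Nat.mul_div_cancel _ (by omega)]
  rw [← hβ]
  exact isLeast_card_gfaces_generate_quaternion_even_card_block heven h4

/-- **`μ(Q₂₄, c) = 172`** (`n = 6`: `(2¹² + 2·2⁴)/24`) — the uniform law at the first non-`2`-power level reproduces lit-andre-3ʼs certificate row
`Census/TwentyFourDicyclic*`. [folklore] -/
theorem isLeast_card_gfaces_generate_quaternion_twentyFour :
    IsLeast {k : ℕ | ∃ S : Finset (CMF (QuaternionGroup 6) (c 6) →₀ ℤ), (↑S ⊆ gfaceSet (QuaternionGroup 6) (c 6) c_mul_c) ∧ S.card = k ∧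
      hodgeSpan (c 6) c_mul_c ≤ Submodule.span ℤ (pairSet (c 6)) ⊔ Submodule.span ℤ (translates (c 6) S)} 172 := by
  have h := isLeast_card_gfaces_generate_quaternion_even_explicit (n := 6) ⟨3, rfl⟩ (by norm_num)
  have hdiv : (Nat.divisors 12).filter (fun d => Odd d) = {1, 3} := by decide
  have ht3 : Nat.totient 3 = 2 := by decide
  rw [show 2 * 6 = 12 by rfl, hdiv, Finset.sum_pair (by decide), Nat.totient_one, ht3] at h
  norm_num at h
  exact h

end

end Summit.HodgeConjecture.CorCM.Census.QuaternionColumn
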